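import Literature.NumberTheory.IwasawaTheory.ClassicalMuVanishesQuadraticAscentUnramified
import Literature.NumberTheory.IwasawaTheory.ClassicalMuVanishesQuadraticAscentNarrowRat
import Literature.NumberTheory.EllipticCurves.ZpExtensionRestrictTwoSqrtTwoAnyDegree
import Literature.NumberTheory.EllipticCurves.ZpExtensionRestrictCyclotomic
import Literature.NumberTheory.IwasawaTheory.ClassicalMuVanishesNormRelationTower
import HarnessLib

/-!
# Iwasawa's `μ₂ = 0` ascends `K(√m)/K` over `ℚ` in the two signature-free situations — `K(√m)` TOTALLY REAL, or `K` TOTALLY COMPLEX —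
# intrinsic forms with `√2 ∉ K(√m)` as the only linear-disjointness input (proved; no definition, no named fact)

`Proofs`-style file (theorems only) in topic `NumberTheory/IwasawaTheory` (namespace `Literature.NumberTheory.IwasawaTheory`), written by the
prover seat `bsd-line-att-p3` g34 (cell `bsd-f1-sign2`; `--supports` stmt-BirchSwinnertonDyer-22298; closes nothing). It packages the two cases of the
quadratic `μ₂`-ascent over `ℚ` in which NO real place ramifies — so Chevalley's archimedean factor is `1` and no unit-signature / narrow datum enters —
in the intrinsic shape of `classicalMu_of_sq_eq_of_odd_finrank` (`ClassicalMuVanishesQuadraticAscentSqrtOdd`, which needs `[K : ℚ]` odd and `K` with at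
most one real place): here the parity/degree hypothesis is replaced by «`√2 ∉ K(√m)`» through the degree-free criterion
`surjective_comp_absGaloisRestrict_of_forall_sq_ne_two'` (cell bsd-f1-sign2, att-p4 g29).

* §1 `classicalMuVanishes_restrict_rat_of_sq_eq_of_isTotallyReal` — `κ` cyclotomic over `ℚ`; `K ⊆ K'` with `K'` TOTALLY REAL, `[K' : K] = 2`,
  `K' = K(x)`, `x² = m ∈ 𝓞_K ∖ 0`, `κ ∘ res` onto for both: `ClassicalMuVanishes (κ|_K) ⟹ ClassicalMuVanishes (κ|_{K'})` (this seat's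
  `classicalMuVanishes_restrict_of_quadratic_of_isTotallyReal` with the ramified primes of the layers counted by
  `ncard_ramified_fieldRange_sup_layer_le_of_sq_eq`).
* §2 ★ `classicalMu_of_sq_eq_of_isTotallyReal` — intrinsic: `K'` totally real, `K' = K(x)`, `x² = m ∈ 𝓞_K ∖ 0`, `[K' : K] = 2`, `√2 ∉ K'`:
  (`μ₂ = 0` for the cyclotomic `ℤ₂`-extensions of `K`) ⟹ (`μ₂ = 0` for every cyclotomic `ℤ₂`-extension of `K'`). E.g. real quadratic over `ℚ`,
  totally real biquadratic over real quadratic, the totally real `S₃`-sextic `ℚ(W[2]) = ℚ(β)(√Δ_W)` over its cubic field when `Δ_W > 0`.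
* §3 ★ `classicalMu_of_sq_eq_of_isTotallyComplex` — intrinsic: `K` TOTALLY COMPLEX, `K' = K(x)`, `x² = m ∈ 𝓞_K ∖ 0`, `[K' : K] = 2`, `√2 ∉ K'`:
  same conclusion (Iwasawa 1973 Thm. 3 «`k` totally imaginary» verbatim; kernel form = cell bsd-2adic's `classicalMuVanishes_restrict_rat_of_sq_eq` with
  vacuous signature hypothesis). E.g. `ℚ(i, √d)` over `ℚ(i)`, `ℚ(W[2], i)` over the CM point field `ℚ(β, i)`.

References: [Iwasawa1973MuInvariants] Thm. 2 and its proof (pp. 7–8), Thm. 3, §4; [Washington1997] §13.1, §13.3 Prop. 13.23; [NeukirchANT1999] Ch. III (2.6).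
-/

set_option autoImplicit false

noncomputable section

open scoped NumberField Classical
open NumberField Field IntermediateField IsDedekindDomain

namespace Literature.NumberTheory.IwasawaTheory

open Literature.NumberTheory.EllipticCurves Literature.NumberTheory.EllipticCurves.ZpExtension
  Literature.NumberTheory.GaloisRepresentations Literature.NumberTheory.NumberFields

/-- A totally complex number field has no ring morphism to `ℝ`. [folklore] -/
private theorem false_of_ringHom_real' {K' : Type} [Field K'] [NumberField K'] [IsTotallyComplex K'] (ρ : K' →+* ℝ) : False := by
  have h : ComplexEmbedding.IsReal (Complex.ofRealHom.comp ρ) := by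
    rw [ComplexEmbedding.isReal_iff]
    ext x
    simp [ComplexEmbedding.conjugate_coe_eq]
  exact IsTotallyComplex.complexEmbedding_not_isReal _ h

/-- `√2 ∉ K' ⟹ √2 ∉ K` for `K ⊆ K'`. [folklore] -/
private theorem forall_sq_ne_two_of_algebra (K K' : Type) [Field K] [Field K'] [Algebra K K'] (h2 : ∀ y : K', y ^ 2 ≠ 2) :
    ∀ y : K, y ^ 2 ≠ 2 := fun y hy ↦
  h2 (algebraMap K K' y) (by rw [← map_pow, hy, map_ofNat])

/-! ## §1 `K'` totally real: the restricted form over `ℚ` -/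

/-- **Iwasawa's `μ₂ = 0` ascends `K(√m)/K` over `ℚ` when `K(√m)` is TOTALLY REAL** (`κ` the cyclotomic `ℤ₂`-extension of `ℚ`; `K ⊆ K'` number fields,
`[K' : K] = 2`, `K' = K(x)`, `x ∈ 𝓞_{K'}`, `x² = m ∈ 𝓞_K ∖ 0`, `K'` totally real, `κ ∘ res` onto for both): `ClassicalMuVanishes (κ|_K) ⟹
ClassicalMuVanishes (κ|_{K'})`. The layers `j'(K')·ℚ_n` are totally real, so nothing ramifies at infinity (archimedean factor `1`); the ramified finite
primes of the layers lie over `N(4m)` (`ncard_ramified_fieldRange_sup_layer_le_of_sq_eq`). [cite: Iwasawa1973MuInvariants, Thm. 2 and its proof (pp. 7–8)]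
[cite: Washington1997, §13.1 and §13.3 Prop. 13.23] [cite: NeukirchANT1999, Ch. III (2.6)] -/
theorem classicalMuVanishes_restrict_rat_of_sq_eq_of_isTotallyReal (κ : ZpExtension ℚ 2) (hκ : κ.IsCyclotomic)
    (K K' : Type) [Field K] [NumberField K] [Field K'] [NumberField K'] [Algebra K K'] [IsTotallyReal K']
    (hdeg : Module.finrank K K' = 2)
    {x : 𝓞 K'} {m : 𝓞 K} (hm : m ≠ 0) (hx : x ^ 2 = algebraMap (𝓞 K) (𝓞 K') m) (hgen : Algebra.adjoin K {(x : K')} = ⊤)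
    (hK : Function.Surjective (κ.toContinuousMonoidHom.comp (absGaloisRestrict ℚ K)))
    (hK' : Function.Surjective (κ.toContinuousMonoidHom.comp (absGaloisRestrict ℚ K')))
    (hμ : ClassicalMuVanishes (κ.restrict K hK)) :
    ClassicalMuVanishes (κ.restrict K' hK') :=
  haveI : Fact (Nat.Prime 2) := ⟨Nat.prime_two⟩
  classicalMuVanishes_restrict_of_quadratic_of_isTotallyReal κ K K' hdeg hK hK' (absEmbedding ℚ K')
    (∑ ℓ ∈ ((Ideal.absNorm (Ideal.span {(4 * m : 𝓞 K)}) : ℤ)).natAbs.primeFactors, Module.finrank ℚ K * ℓ ^ 2)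
    (fun n ↦ ncard_ramified_fieldRange_sup_layer_le_of_sq_eq κ hκ K K' hdeg hm hx hgen hK hK' (absEmbedding ℚ K') n) hμ

/-! ## §2 `K'` totally real: intrinsic form -/

/-- ★ **`μ₂ = 0` ascends `K(√m)/K` with `K(√m)` totally real — intrinsic form.** `K ⊆ K'` number fields, `K'` TOTALLY REAL, `[K' : K] = 2`, `K' = K(x)`
with `x ∈ 𝓞_{K'}`, `x² = m ∈ 𝓞_K ∖ 0`, and `√2 ∉ K'` (so `K` and `K'` are linearly disjoint from `ℚ_∞`, degree-free criterion). If `μ₂ = 0` (growth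
form) for the cyclotomic `ℤ₂`-extensions of `K`, then for every cyclotomic `ℤ₂`-extension of `K'`. No unit signatures, no narrow class numbers.
[cite: Iwasawa1973MuInvariants, Thm. 2 and its proof (pp. 7–8)] [cite: Washington1997, §13.3 Prop. 13.23] -/
theorem classicalMu_of_sq_eq_of_isTotallyReal (K K' : Type) [Field K] [NumberField K] [Field K'] [NumberField K'] [Algebra K K']
    [IsTotallyReal K'] (hdeg : Module.finrank K K' = 2)
    {x : 𝓞 K'} {m : 𝓞 K} (hm : m ≠ 0) (hx : x ^ 2 = algebraMap (𝓞 K) (𝓞 K') m) (hgen : Algebra.adjoin K {(x : K')} = ⊤)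
    (h2 : ∀ y : K', y ^ 2 ≠ 2)
    (hμ : ∀ κP : ZpExtension K 2, κP.IsCyclotomic → ClassicalMuVanishes κP) :
    ∀ κ' : ZpExtension K' 2, κ'.IsCyclotomic → ClassicalMuVanishes κ' := by
  intro κ' hκ'
  haveI : Fact (Nat.Prime 2) := ⟨Nat.prime_two⟩
  obtain ⟨κ, hκ⟩ := exists_cyclotomicZpExtension_holds ℚ 2
  have hK : Function.Surjective (κ.toContinuousMonoidHom.comp (absGaloisRestrict ℚ K)) :=
    surjective_comp_absGaloisRestrict_of_forall_sq_ne_two' κ K hκ (forall_sq_ne_two_of_algebra K K' h2)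
  have hK' : Function.Surjective (κ.toContinuousMonoidHom.comp (absGaloisRestrict ℚ K')) :=
    surjective_comp_absGaloisRestrict_of_forall_sq_ne_two' κ K' hκ h2
  have h1 : ClassicalMuVanishes (κ.restrict K hK) := hμ _ (isCyclotomic_restrict κ hκ K hK)
  have h2' : ClassicalMuVanishes (κ.restrict K' hK') :=
    classicalMuVanishes_restrict_rat_of_sq_eq_of_isTotallyReal κ hκ K K' hdeg hm hx hgen hK hK' h1
  exact (classicalMuVanishes_iff_of_isCyclotomic _ _ (isCyclotomic_restrict κ hκ _ hK') hκ').mp h2'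

/-! ## §3 `K` totally complex: intrinsic form (Iwasawa 1973, Thm. 3 verbatim) -/

/-- ★ **`μ₂ = 0` ascends `K(√m)/K` with `K` totally complex — intrinsic form** (Iwasawa 1973 Thm. 3, «`k` totally imaginary», `ℓ = 2`). `K ⊆ K'` number
fields, `K` TOTALLY COMPLEX, `[K' : K] = 2`, `K' = K(x)` with `x ∈ 𝓞_{K'}`, `x² = m ∈ 𝓞_K ∖ 0`, `√2 ∉ K'`: if `μ₂ = 0` for the cyclotomic `ℤ₂`-extensions
of `K`, then for every cyclotomic `ℤ₂`-extension of `K'`. (`K'` is totally complex and `K` has no real embedding, so cell bsd-2adic's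
`classicalMuVanishes_restrict_rat_of_sq_eq` applies with vacuous signature hypothesis.) E.g. `ℚ(i, √d)/ℚ(i)`, `ℚ(W[2], i)/ℚ(β, i)`.
[cite: Iwasawa1973MuInvariants, Thm. 3 and §4] [cite: Washington1997, §13.3 Prop. 13.23] -/
theorem classicalMu_of_sq_eq_of_isTotallyComplex (K K' : Type) [Field K] [NumberField K] [Field K'] [NumberField K'] [Algebra K K']
    [IsTotallyComplex K] (hdeg : Module.finrank K K' = 2)
    {x : 𝓞 K'} {m : 𝓞 K} (hm : m ≠ 0) (hx : x ^ 2 = algebraMap (𝓞 K) (𝓞 K') m) (hgen : Algebra.adjoin K {(x : K')} = ⊤)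
    (h2 : ∀ y : K', y ^ 2 ≠ 2)
    (hμ : ∀ κP : ZpExtension K 2, κP.IsCyclotomic → ClassicalMuVanishes κP) :
    ∀ κ' : ZpExtension K' 2, κ'.IsCyclotomic → ClassicalMuVanishes κ' := by
  intro κ' hκ'
  haveI : Fact (Nat.Prime 2) := ⟨Nat.prime_two⟩
  haveI : IsTotallyComplex K' := isTotallyComplex_of_algebra (F := K) K'
  haveI : Subsingleton (K →+* ℝ) := ⟨fun φ _ ↦ (false_of_ringHom_real' φ).elim⟩
  obtain ⟨κ, hκ⟩ := exists_cyclotomicZpExtension_holds ℚ 2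
  have hK : Function.Surjective (κ.toContinuousMonoidHom.comp (absGaloisRestrict ℚ K)) :=
    surjective_comp_absGaloisRestrict_of_forall_sq_ne_two' κ K hκ (forall_sq_ne_two_of_algebra K K' h2)
  have hK' : Function.Surjective (κ.toContinuousMonoidHom.comp (absGaloisRestrict ℚ K')) :=
    surjective_comp_absGaloisRestrict_of_forall_sq_ne_two' κ K' hκ h2
  have h1 : ClassicalMuVanishes (κ.restrict K hK) := hμ _ (isCyclotomic_restrict κ hκ K hK)
  have h2' : ClassicalMuVanishes (κ.restrict K' hK') :=
    classicalMuVanishes_restrict_rat_of_sq_eq κ hκ K K' hdeg hm hx hgen hK hK' h1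
  exact (classicalMuVanishes_iff_of_isCyclotomic _ _ (isCyclotomic_restrict κ hκ _ hK') hκ').mp h2'

end Literature.NumberTheory.IwasawaTheory

end
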